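import Mathlib
import Literature.Analysis.FluidPDE.TorusABCFlow
import Literature.Analysis.FluidPDE.LinearizedNSTorus
import Literature.Analysis.FluidPDE.CheskidovPeriodisation
import HarnessLib

/-!
# The forced ABC flow as an exact steady Navier–Stokes state on `T³` (instab g8, cell `ns-blowup`, 2026-08-25)

HONEST FRAMING (human ruling D-0035): nothing here is a claim about Navier–Stokes blow-up.
WHAT THIS IS NOT: not NS blow-up evidence. It records, in the tree's torus vocabulary
(`Literature.Analysis.FluidPDE.Torus.IsSteadyNSState` of `LinearizedNSTorus`), the elementary fact
on which lane N1* of the cell rests: the ABC flow `U = Torus.abcFlow A B C` on the unit torus,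
maintained by the time-independent force `f = 4π²ν·U`, is an EXACT smooth steady solution of the
forced incompressible Navier–Stokes system with the Bernoulli pressure `−|U|²/2` — so the cell's
crux X0 (a certified eigenvalue of `L(ν, U) = νΔ − (U·∇) − (·∇)U − ∇q`) is a statement about the
linearisation of TRUE forced NS at an exact steady state (INSTAB-BRIDGE.md §10 l.96), and the named
fact `Torus.fps2006_nonlinear_instability_of_eigenvalue` (Friedlander–Pavlović–Shvydkoy 2006) applies
to it verbatim (rung R-α, filed separately once that Literature module lands).

* `isSteadyNSState_abcFlow` — `Torus.IsSteadyNSState ν (4π²ν·U) U (−|U|²/2)` for all `ν A B C`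
  (`(U·∇)U = ∇(|U|²/2)` by `Torus.convect_abcFlow_self`, `ΔU = −4π²U` by `Torus.laplacian_abcFlow`).

Mathlib + Literature only; no new definitions.
-/

noncomputable section

namespace Summit.NavierStokesRegularity.FluidComputer.AbcForcedSteadyState

open Literature.Analysis.FunctionSpaces Literature.Analysis.FluidPDE Set

/-- **The forced ABC flow is a steady Navier–Stokes state.** For every `ν, A, B, C`, the field
`U = Torus.abcFlow A B C` with pressure `p = −|U|²/2` is a smooth steady classical solution of
`∂ₜu + (u·∇)u = νΔu − ∇p + f` on `T³` with the time-independent force `f = (4π²ν)·U`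
(`Torus.IsSteadyNSState`): `(U·∇)U = ∇(|U|²/2)` (Beltrami), `νΔU + f = −4π²νU + 4π²νU = 0`. -/
theorem isSteadyNSState_abcFlow (ν A B C : ℝ) :
    Torus.IsSteadyNSState ν (fun x => (4 * Real.pi ^ 2 * ν) • Torus.abcFlow A B C x)
      (Torus.abcFlow A B C) (fun x => -(‖Torus.abcFlow A B C x‖ ^ 2 / 2)) := by
  have hU : Torus.IsSmooth (Torus.abcFlow A B C) := Torus.isSmooth_abcFlow A B C
  have hq : Torus.IsSmooth (fun x => ‖Torus.abcFlow A B C x‖ ^ 2 / 2) := (hU.norm_sq).div_const 2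
  have hp : Torus.IsSmooth (fun x => -(‖Torus.abcFlow A B C x‖ ^ 2 / 2)) := hq.neg
  refine ⟨Torus.isSmoothSpaceTimeOn_const hU _, Torus.isSmoothSpaceTimeOn_const hp _,
    fun t _ y => ?_, fun _ _ => Torus.isDivFree_abcFlow A B C⟩
  have ht : Torus.timeDerivWithin Set.univ (fun _ : ℝ => Torus.abcFlow A B C) t y = 0 := by
    simp [Torus.timeDerivWithin]
  rw [ht, zero_add, Torus.convect_abcFlow_self, Torus.laplacian_abcFlow,
    Torus.gradient_neg (hq.isContDiff (by exact_mod_cast le_top)) y]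
  rw [smul_neg, sub_neg_eq_add, smul_smul]
  have : (ν * (4 * Real.pi ^ 2)) = 4 * Real.pi ^ 2 * ν := by ring
  rw [this]
  abel

end Summit.NavierStokesRegularity.FluidComputer.AbcForcedSteadyState
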